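import Literature.NumberTheory.Automorphic.CongruenceSubgroupPropertySL2AwayArith
import Literature.NumberTheory.EllipticCurves.Gamma0CocycleDegeneracyMaps
import Mathlib.NumberTheory.Padics.PadicNorm
import HarnessLib

/-!
# The `t`-adic size of elements of `ℤ[1/t]` and of the rows of a matrix in `SL₂(ℤ[1/t])`
# (the distance-to-the-root bookkeeping on the Bruhat–Tits tree of `SL₂(ℚ_t)`, in coordinates)

Topic `Literature/NumberTheory/EllipticCurves` (supporting `Gamma0AwayCharacterExtension.lean`, the named fact
`gamma0Away_character_extension_of_shiftInvariant`; sub-namespace `Gamma0Away` for the objects attached to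
`Γ₀(L′; ℤ[1/t])`).  For a prime `t` we set up

* `Gamma0Away.toRat t : ℤ[1/t] →+* ℚ`, the structure embedding, and the `t`-ADIC SIZE
  `Gamma0Away.tsize t x = ‖x‖_t := padicNorm t (toRat t x)` (multiplicative, ultrametric, `‖z‖_t ≤ 1` on `ℤ`
  with equality iff `t ∤ z`, `‖1/t‖_t = t`);
* for `g ∈ SL₂(ℤ[1/t])` the sizes of its two ROWS, `topSize g = max ‖g₀₀‖ ‖g₀₁‖` and
  `botSize g = max ‖g₁₀‖ ‖g₁₁‖` (both `> 0`, as `det g = 1`), the HEIGHT `height g = max topSize botSize`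
  and the HALF-TREE predicate `TopHeavy g : botSize g < topSize g`.

Dictionary with Serre's tree `X` of `SL₂(ℚ_t)` (vertices = classes of `ℤ_t`-lattices, root `v₀ = [ℤ_t²]`,
`v₁ = [ℤ_t ⊕ tℤ_t]`; *Trees* II §1.1): `height g = t^{d(v₀, g v₀)/2}` and `TopHeavy g` iff the geodesic from
`v₀` to `g v₀` leaves through the edge `v₀v₁` (the half-tree behind `v₁`).  We never build the tree: the
two facts the ping-pong needs — how the row sizes change under left multiplication by a matrix whose rows
have known sizes — are the ultrametric ROW LEMMA `rowSize_mul_le` / `rowSize_mul_eq_of_lt` below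
(`‖A x + B y‖ = ‖A x‖` when `‖B y‖ < ‖A x‖`); plus the shift conjugation `theta = Ad(diag(t,1)⁻¹)`.

## References

* J.-P. Serre, *Trees*, Springer (1980), Ch. II §1.1 (the tree of `SL₂` over a discretely valued field;
  distance via elementary divisors), §1.4. [SerreTrees1980]
-/

noncomputable section

open scoped MatrixGroups

namespace Literature.NumberTheory.EllipticCurves

namespace Gamma0Away

/-! ### `ℤ[1/t]`: the inverse of `t` and the shift conjugation -/

section Basic

variable (t : ℕ)

/-- `t · (1/t) = 1` in `ℤ[1/t]`. [cite: SerreTrees1980, Ch. II §1.1] -/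
theorem natCast_mul_invSelf :
    (t : Localization.Away (t : ℤ)) * IsLocalization.Away.invSelf (S := Localization.Away (t : ℤ)) (t : ℤ)
      = 1 := by
  have h := IsLocalization.Away.mul_invSelf (S := Localization.Away (t : ℤ)) (t : ℤ)
  simpa using h

/-- Every element of `ℤ[1/t]` is an integer times a power of `1/t`. [cite: SerreTrees1980, Ch. II §1.1] -/
theorem exists_eq_intCast_mul_invSelf_pow (x : Localization.Away (t : ℤ)) :
    ∃ (z : ℤ) (k : ℕ), x = (z : Localization.Away (t : ℤ)) *
      IsLocalization.Away.invSelf (S := Localization.Away (t : ℤ)) (t : ℤ) ^ k := by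
  obtain ⟨z, k, hzk⟩ := Automorphic.SerreSL2.Away.exists_mul_pow_eq_intCast (m := t) x
  refine ⟨z, k, ?_⟩
  rw [← hzk, mul_assoc, ← mul_pow, natCast_mul_invSelf, one_pow, mul_one]


/-! ### The shift conjugation `θ = Ad(diag(t,1)⁻¹)` of `SL₂(ℤ[1/t])` -/

/-- The matrix `θ(g) = diag(t,1)⁻¹ · g · diag(t,1) = (a, b/t; tc, d)` of `g = (a b; c d) ∈ SL₂(ℤ[1/t])` (plain
function; the homomorphism is `theta`). [cite: SerreTrees1980, Ch. II §1.4] -/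
def thetaAux (g : SL(2, Localization.Away (t : ℤ))) : SL(2, Localization.Away (t : ℤ)) :=
  ⟨!![g 0 0, g 0 1 * IsLocalization.Away.invSelf (S := Localization.Away (t : ℤ)) (t : ℤ);
      (t : Localization.Away (t : ℤ)) * g 1 0, g 1 1], by
    have hdet : g 0 0 * g 1 1 - g 0 1 * g 1 0 = 1 := by
      have := Matrix.det_fin_two (g : Matrix (Fin 2) (Fin 2) (Localization.Away (t : ℤ)))
      rw [g.det_coe] at this
      exact this.symm
    rw [Matrix.det_fin_two_of]
    linear_combination hdet - (g 0 1 * g 1 0) * natCast_mul_invSelf t⟩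

/-- Entry `(0,0)` of `θ(g)`: `a`. [cite: SerreTrees1980, Ch. II §1.4] -/
@[simp] theorem thetaAux_apply_00 (g : SL(2, Localization.Away (t : ℤ))) : thetaAux t g 0 0 = g 0 0 := rfl

/-- Entry `(0,1)` of `θ(g)`: `b/t`. [cite: SerreTrees1980, Ch. II §1.4] -/
@[simp] theorem thetaAux_apply_01 (g : SL(2, Localization.Away (t : ℤ))) :
    thetaAux t g 0 1 = g 0 1 * IsLocalization.Away.invSelf (S := Localization.Away (t : ℤ)) (t : ℤ) := rfl

/-- Entry `(1,0)` of `θ(g)`: `t c`. [cite: SerreTrees1980, Ch. II §1.4] -/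
@[simp] theorem thetaAux_apply_10 (g : SL(2, Localization.Away (t : ℤ))) :
    thetaAux t g 1 0 = (t : Localization.Away (t : ℤ)) * g 1 0 := rfl

/-- Entry `(1,1)` of `θ(g)`: `d`. [cite: SerreTrees1980, Ch. II §1.4] -/
@[simp] theorem thetaAux_apply_11 (g : SL(2, Localization.Away (t : ℤ))) : thetaAux t g 1 1 = g 1 1 := rfl

/-- **The shift conjugation** `θ = Ad(diag(t,1)⁻¹) : SL₂(ℤ[1/t]) →* SL₂(ℤ[1/t])`, `θ(a b; c d) = (a, b/t; tc, d)`
— conjugation by `diag(t,1) ∈ GL₂(ℤ[1/t])`, which normalises `SL₂(ℤ[1/t])`; on the tree it moves the root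
`v₀` to its neighbour `v₁ = diag(t,1)⁻¹ v₀`, so `θ(Stab v₀) = Stab v₁` and the second copy of `SL₂(ℤ)` in
Ihara's amalgam `SL₂(ℤ[1/t]) = SL₂(ℤ) *_{Γ₀(t)} SL₂(ℤ)′` is `θ(SL₂(ℤ))`. [cite: SerreTrees1980, Ch. II §1.4] -/
def theta : SL(2, Localization.Away (t : ℤ)) →* SL(2, Localization.Away (t : ℤ)) where
  toFun := thetaAux t
  map_one' := by
    ext i j
    fin_cases i <;> fin_cases j <;> simp [thetaAux]
  map_mul' g h := by
    have hts := natCast_mul_invSelf t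
    ext i j
    fin_cases i <;> fin_cases j
    · show thetaAux t (g * h) 0 0 = (thetaAux t g * thetaAux t h) 0 0
      rw [thetaAux_apply_00, Automorphic.SL2Rel.mul_apply_two, Automorphic.SL2Rel.mul_apply_two,
        thetaAux_apply_00, thetaAux_apply_00, thetaAux_apply_01, thetaAux_apply_10]
      linear_combination -(g 0 1 * h 1 0) * hts
    · show thetaAux t (g * h) 0 1 = (thetaAux t g * thetaAux t h) 0 1
      rw [thetaAux_apply_01, Automorphic.SL2Rel.mul_apply_two, Automorphic.SL2Rel.mul_apply_two,
        thetaAux_apply_00, thetaAux_apply_01, thetaAux_apply_01, thetaAux_apply_11]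
      ring
    · show thetaAux t (g * h) 1 0 = (thetaAux t g * thetaAux t h) 1 0
      rw [thetaAux_apply_10, Automorphic.SL2Rel.mul_apply_two, Automorphic.SL2Rel.mul_apply_two,
        thetaAux_apply_10, thetaAux_apply_00, thetaAux_apply_11, thetaAux_apply_10]
      ring
    · show thetaAux t (g * h) 1 1 = (thetaAux t g * thetaAux t h) 1 1
      rw [thetaAux_apply_11, Automorphic.SL2Rel.mul_apply_two, Automorphic.SL2Rel.mul_apply_two,
        thetaAux_apply_10, thetaAux_apply_01, thetaAux_apply_11, thetaAux_apply_11]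
      linear_combination -(g 1 0 * h 0 1) * hts

/-- Unfolding `theta`. [cite: SerreTrees1980, Ch. II §1.4] -/
@[simp] theorem theta_apply (g : SL(2, Localization.Away (t : ℤ))) : theta t g = thetaAux t g := rfl

/-- **`θ` undoes the degeneracy conjugation**: for `γ ∈ Γ₀(L′t)`,
`θ(ι(diag(t,1) γ diag(t,1)⁻¹)) = ι γ` in `SL₂(ℤ[1/t])` (`ι : SL₂(ℤ) → SL₂(ℤ[1/t])`), i.e. the two embeddings
`ι` and `θ ∘ ι` of `Γ₀(L′)` agree on `Γ₀(L′t)` along (inclusion, `Gamma0.degeneracyConj L′ (L′t) t`).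
[cite: SerreTrees1980, Ch. II §1.4] -/
theorem theta_map_degeneracyConj (L' : ℕ) [NeZero t] (γ : CongruenceSubgroup.Gamma0 (L' * t)) :
    theta t (Matrix.SpecialLinearGroup.map (Int.castRingHom (Localization.Away (t : ℤ)))
        ((ModularForms.Gamma0.degeneracyConj L' (L' * t) t dvd_rfl γ : CongruenceSubgroup.Gamma0 L') :
          SL(2, ℤ))) =
      Matrix.SpecialLinearGroup.map (Int.castRingHom (Localization.Away (t : ℤ))) (γ : SL(2, ℤ)) := by
  have hts := natCast_mul_invSelf t
  have hdvd : (t : ℤ) ∣ (γ : SL(2, ℤ)) 1 0 := by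
    have hγ := γ.2
    rw [CongruenceSubgroup.Gamma0_mem] at hγ
    have := (ZMod.intCast_zmod_eq_zero_iff_dvd _ _).mp hγ
    exact (dvd_trans (by push_cast; exact dvd_mul_left _ _) this)
  have hct : (((γ : SL(2, ℤ)) 1 0 / (t : ℤ) : ℤ) : Localization.Away (t : ℤ)) * (t : Localization.Away (t : ℤ))
      = (((γ : SL(2, ℤ)) 1 0 : ℤ) : Localization.Away (t : ℤ)) := by
    have := congrArg (fun z : ℤ => (z : Localization.Away (t : ℤ))) (Int.ediv_mul_cancel hdvd)
    push_cast at this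
    exact this
  ext i j
  fin_cases i <;> fin_cases j
  · rfl
  · show (((t : ℤ) * (γ : SL(2, ℤ)) 0 1 : ℤ) : Localization.Away (t : ℤ)) *
        IsLocalization.Away.invSelf (S := Localization.Away (t : ℤ)) (t : ℤ) = (((γ : SL(2, ℤ)) 0 1 : ℤ) : _)
    push_cast
    linear_combination (((γ : SL(2, ℤ)) 0 1 : ℤ) : Localization.Away (t : ℤ)) * hts
  · show (t : Localization.Away (t : ℤ)) * ((((γ : SL(2, ℤ)) 1 0 / (t : ℤ) : ℤ) : Localization.Away (t : ℤ)))
        = (((γ : SL(2, ℤ)) 1 0 : ℤ) : _)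
    rw [mul_comm]; exact hct
  · rfl

end Basic

variable (t : ℕ) [Fact t.Prime]

/-! ### `ℤ[1/t] ⊂ ℚ` and the `t`-adic size -/

/-- `t ≠ 0` in `ℚ` (plumbing). [folklore] -/
private theorem natCast_ne_zero_rat : (t : ℚ) ≠ 0 := by exact_mod_cast (Fact.out : t.Prime).ne_zero

/-- `t` is invertible in `ℚ` (plumbing). [folklore] -/
private theorem isUnit_castRingHom_natCast : IsUnit (Int.castRingHom ℚ (t : ℤ)) :=
  isUnit_iff_ne_zero.mpr (by rw [eq_intCast, Int.cast_natCast]; exact natCast_ne_zero_rat t)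

/-- The structure embedding `ℤ[1/t] → ℚ` (`t ≠ 0` is invertible in `ℚ`). [cite: SerreTrees1980, Ch. II §1.1] -/
def toRat : Localization.Away (t : ℤ) →+* ℚ :=
  Localization.awayLift (Int.castRingHom ℚ) (t : ℤ) (isUnit_castRingHom_natCast t)

/-- `toRat` on integers. [cite: SerreTrees1980, Ch. II §1.1] -/
@[simp] theorem toRat_intCast (z : ℤ) : toRat t (z : Localization.Away (t : ℤ)) = z := by
  have h : toRat t (algebraMap ℤ (Localization.Away (t : ℤ)) z) = Int.castRingHom ℚ z :=
    IsLocalization.Away.lift_eq (t : ℤ) (isUnit_castRingHom_natCast t) z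
  simpa only [eq_intCast] using h

/-- `toRat` on naturals. [cite: SerreTrees1980, Ch. II §1.1] -/
@[simp] theorem toRat_natCast (n : ℕ) : toRat t (n : Localization.Away (t : ℤ)) = n := by
  have h := toRat_intCast t (n : ℤ)
  push_cast at h
  exact h

/-- `toRat (1/t) = t⁻¹`. [cite: SerreTrees1980, Ch. II §1.1] -/
@[simp] theorem toRat_invSelf :
    toRat t (IsLocalization.Away.invSelf (S := Localization.Away (t : ℤ)) (t : ℤ)) = (t : ℚ)⁻¹ := by
  have h := congrArg (toRat t) (natCast_mul_invSelf t)
  rw [map_mul, map_one, toRat_natCast] at h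
  exact eq_inv_of_mul_eq_one_right h

/-- The `t`-adic size `‖x‖_t = t^{-v_t(x)}` of `x ∈ ℤ[1/t]` (`0` for `x = 0`). [cite: SerreTrees1980, Ch. II §1.1] -/
def tsize (x : Localization.Away (t : ℤ)) : ℚ := padicNorm t (toRat t x)

/-- `‖·‖_t ≥ 0`. [cite: SerreTrees1980, Ch. II §1.1] -/
theorem tsize_nonneg (x : Localization.Away (t : ℤ)) : 0 ≤ tsize t x := padicNorm.nonneg _

/-- `‖x y‖_t = ‖x‖_t ‖y‖_t`. [cite: SerreTrees1980, Ch. II §1.1] -/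
@[simp] theorem tsize_mul (x y : Localization.Away (t : ℤ)) : tsize t (x * y) = tsize t x * tsize t y := by
  simp [tsize, padicNorm.mul]

/-- `‖1‖_t = 1`. [cite: SerreTrees1980, Ch. II §1.1] -/
@[simp] theorem tsize_one : tsize t 1 = 1 := by simp [tsize]

/-- `‖0‖_t = 0`. [cite: SerreTrees1980, Ch. II §1.1] -/
@[simp] theorem tsize_zero : tsize t 0 = 0 := by simp [tsize]

/-- `‖-x‖_t = ‖x‖_t`. [cite: SerreTrees1980, Ch. II §1.1] -/
@[simp] theorem tsize_neg (x : Localization.Away (t : ℤ)) : tsize t (-x) = tsize t x := by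
  simp [tsize]

/-- Ultrametric inequality. [cite: SerreTrees1980, Ch. II §1.1] -/
theorem tsize_add_le (x y : Localization.Away (t : ℤ)) : tsize t (x + y) ≤ max (tsize t x) (tsize t y) := by
  simp only [tsize, map_add]
  exact padicNorm.nonarchimedean

/-- On integers `‖z‖_t ≤ 1`. [cite: SerreTrees1980, Ch. II §1.1] -/
theorem tsize_intCast_le_one (z : ℤ) : tsize t (z : Localization.Away (t : ℤ)) ≤ 1 := by
  simpa [tsize] using padicNorm.of_int (p := t) z

/-- `‖z‖_t = 1 ↔ t ∤ z` for an integer `z`. [cite: SerreTrees1980, Ch. II §1.1] -/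
theorem tsize_intCast_eq_one_iff (z : ℤ) : tsize t (z : Localization.Away (t : ℤ)) = 1 ↔ ¬ (t : ℤ) ∣ z := by
  simpa [tsize] using padicNorm.int_eq_one_iff (p := t) z

/-- `‖z‖_t < 1 ↔ t ∣ z` for an integer `z`. [cite: SerreTrees1980, Ch. II §1.1] -/
theorem tsize_intCast_lt_one_iff (z : ℤ) : tsize t (z : Localization.Away (t : ℤ)) < 1 ↔ (t : ℤ) ∣ z := by
  simpa [tsize] using padicNorm.int_lt_one_iff (p := t) z

/-- `‖t‖_t = t⁻¹`. [cite: SerreTrees1980, Ch. II §1.1] -/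
@[simp] theorem tsize_natCast_self : tsize t (t : Localization.Away (t : ℤ)) = (t : ℚ)⁻¹ := by
  simp [tsize, padicNorm.padicNorm_p_of_prime (p := t)]

/-- `‖1/t‖_t = t`. [cite: SerreTrees1980, Ch. II §1.1] -/
@[simp] theorem tsize_invSelf :
    tsize t (IsLocalization.Away.invSelf (S := Localization.Away (t : ℤ)) (t : ℤ)) = (t : ℚ) := by
  have h := congrArg (tsize t) (natCast_mul_invSelf t)
  rw [tsize_mul, tsize_natCast_self, tsize_one] at h
  exact ((inv_mul_eq_one₀ (natCast_ne_zero_rat t)).1 h).symm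

/-- `1 < t` in `ℚ`. [cite: SerreTrees1980, Ch. II §1.1] -/
theorem one_lt_natCast : (1 : ℚ) < t := by exact_mod_cast (Fact.out : t.Prime).one_lt

/-! ### Row sizes of a matrix in `SL₂(ℤ[1/t])` -/

/-- Size of the top row `max ‖g₀₀‖_t ‖g₀₁‖_t`. [cite: SerreTrees1980, Ch. II §1.1] -/
def topSize (g : SL(2, Localization.Away (t : ℤ))) : ℚ := max (tsize t (g 0 0)) (tsize t (g 0 1))

/-- Size of the bottom row `max ‖g₁₀‖_t ‖g₁₁‖_t`. [cite: SerreTrees1980, Ch. II §1.1] -/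
def botSize (g : SL(2, Localization.Away (t : ℤ))) : ℚ := max (tsize t (g 1 0)) (tsize t (g 1 1))

/-- The height `max topSize botSize` (`= t^{d(v₀, g v₀)/2}` on the tree). [cite: SerreTrees1980, Ch. II §1.1] -/
def height (g : SL(2, Localization.Away (t : ℤ))) : ℚ := max (topSize t g) (botSize t g)

/-- The half-tree predicate: the top row is `t`-adically larger than the bottom row (`g v₀` lies behind
`v₁ = [ℤ_t ⊕ tℤ_t]` as seen from `v₀`). [cite: SerreTrees1980, Ch. II §1.1] -/
def TopHeavy (g : SL(2, Localization.Away (t : ℤ))) : Prop := botSize t g < topSize t g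

/-- `topSize · botSize ≥ 1` (from `det = 1` and the ultrametric inequality); in particular both row sizes
are positive. [cite: SerreTrees1980, Ch. II §1.1] -/
theorem one_le_topSize_mul_botSize (g : SL(2, Localization.Away (t : ℤ))) :
    1 ≤ topSize t g * botSize t g := by
  have hdet : g 0 0 * g 1 1 + -(g 0 1 * g 1 0) = 1 := by
    have := Matrix.det_fin_two (g : Matrix (Fin 2) (Fin 2) (Localization.Away (t : ℤ)))
    rw [g.det_coe] at this
    linear_combination -this
  have h1 : (1 : ℚ) ≤ max (tsize t (g 0 0 * g 1 1)) (tsize t (-(g 0 1 * g 1 0))) := by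
    have := tsize_add_le t (g 0 0 * g 1 1) (-(g 0 1 * g 1 0))
    rwa [hdet, tsize_one] at this
  rw [tsize_neg, tsize_mul, tsize_mul] at h1
  have hT0 := tsize_nonneg t (g 0 0); have hT1 := tsize_nonneg t (g 0 1)
  have hB0 := tsize_nonneg t (g 1 0); have hB1 := tsize_nonneg t (g 1 1)
  rcases le_max_iff.1 h1 with h | h
  · calc (1 : ℚ) ≤ tsize t (g 0 0) * tsize t (g 1 1) := h
      _ ≤ topSize t g * botSize t g :=
        mul_le_mul (le_max_left _ _) (le_max_right _ _) hB1 (le_trans hT0 (le_max_left _ _))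
  · calc (1 : ℚ) ≤ tsize t (g 0 1) * tsize t (g 1 0) := h
      _ ≤ topSize t g * botSize t g :=
        mul_le_mul (le_max_right _ _) (le_max_left _ _) hB0 (le_trans hT0 (le_max_left _ _))

/-- `topSize > 0`. [cite: SerreTrees1980, Ch. II §1.1] -/
theorem topSize_pos (g : SL(2, Localization.Away (t : ℤ))) : 0 < topSize t g := by
  have h := one_le_topSize_mul_botSize t g
  have hB : 0 ≤ botSize t g := le_trans (tsize_nonneg t _) (le_max_left _ _)
  have hT : 0 ≤ topSize t g := le_trans (tsize_nonneg t _) (le_max_left _ _)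
  rcases hT.lt_or_eq with hT' | hT'
  · exact hT'
  · rw [← hT', zero_mul] at h; exact absurd h (by norm_num)

/-- `botSize > 0`. [cite: SerreTrees1980, Ch. II §1.1] -/
theorem botSize_pos (g : SL(2, Localization.Away (t : ℤ))) : 0 < botSize t g := by
  have h := one_le_topSize_mul_botSize t g
  have hB : 0 ≤ botSize t g := le_trans (tsize_nonneg t _) (le_max_left _ _)
  rcases hB.lt_or_eq with hB' | hB'
  · exact hB'
  · rw [← hB', mul_zero] at h; exact absurd h (by norm_num)

/-! ### The row lemma -/

/-- **Row lemma, inequality**: the row `A·(x₀,x₁) + B·(y₀,y₁)` has size at most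
`max (‖A‖·‖(x₀,x₁)‖) (‖B‖·‖(y₀,y₁)‖)`. [cite: SerreTrees1980, Ch. II §1.1] -/
theorem rowSize_mul_le (A B x₀ x₁ y₀ y₁ : Localization.Away (t : ℤ)) :
    max (tsize t (A * x₀ + B * y₀)) (tsize t (A * x₁ + B * y₁)) ≤
      max (tsize t A * max (tsize t x₀) (tsize t x₁)) (tsize t B * max (tsize t y₀) (tsize t y₁)) := by
  have hA := tsize_nonneg t A; have hB := tsize_nonneg t B
  refine max_le ?_ ?_
  · refine (tsize_add_le t _ _).trans (max_le_max ?_ ?_)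
    · rw [tsize_mul]; exact mul_le_mul_of_nonneg_left (le_max_left _ _) hA
    · rw [tsize_mul]; exact mul_le_mul_of_nonneg_left (le_max_left _ _) hB
  · refine (tsize_add_le t _ _).trans (max_le_max ?_ ?_)
    · rw [tsize_mul]; exact mul_le_mul_of_nonneg_left (le_max_right _ _) hA
    · rw [tsize_mul]; exact mul_le_mul_of_nonneg_left (le_max_right _ _) hB

/-- **Row lemma, equality**: if `‖B‖·‖(y₀,y₁)‖ < ‖A‖·‖(x₀,x₁)‖` then the row `A·(x₀,x₁) + B·(y₀,y₁)` has size
exactly `‖A‖·‖(x₀,x₁)‖` (ultrametric equality at the dominant coordinate). [cite: SerreTrees1980, Ch. II §1.1] -/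
theorem rowSize_mul_eq_of_lt (A B x₀ x₁ y₀ y₁ : Localization.Away (t : ℤ))
    (h : tsize t B * max (tsize t y₀) (tsize t y₁) < tsize t A * max (tsize t x₀) (tsize t x₁)) :
    max (tsize t (A * x₀ + B * y₀)) (tsize t (A * x₁ + B * y₁)) =
      tsize t A * max (tsize t x₀) (tsize t x₁) := by
  have hA := tsize_nonneg t A; have hB := tsize_nonneg t B
  apply le_antisymm
  · refine (rowSize_mul_le t A B x₀ x₁ y₀ y₁).trans ?_
    exact max_le le_rfl h.le
  · -- the dominant coordinate
    rcases le_total (tsize t x₁) (tsize t x₀) with hx | hx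
    · rw [max_eq_left hx] at h ⊢
      have hlt : tsize t (B * y₀) < tsize t (A * x₀) := by
        rw [tsize_mul, tsize_mul]
        exact lt_of_le_of_lt (mul_le_mul_of_nonneg_left (le_max_left _ _) hB) h
      have heq : tsize t (A * x₀ + B * y₀) = tsize t (A * x₀) := by
        simp only [tsize, map_add] at hlt ⊢
        rw [padicNorm.add_eq_max_of_ne (ne_of_gt hlt), max_eq_left hlt.le]
      rw [← tsize_mul, ← heq]
      exact le_max_left _ _
    · rw [max_eq_right hx] at h ⊢
      have hlt : tsize t (B * y₁) < tsize t (A * x₁) := by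
        rw [tsize_mul, tsize_mul]
        exact lt_of_le_of_lt (mul_le_mul_of_nonneg_left (le_max_right _ _) hB) h
      have heq : tsize t (A * x₁ + B * y₁) = tsize t (A * x₁) := by
        simp only [tsize, map_add] at hlt ⊢
        rw [padicNorm.add_eq_max_of_ne (ne_of_gt hlt), max_eq_left hlt.le]
      rw [← tsize_mul, ← heq]
      exact le_max_right _ _

/-- Row lemma with the roles of the two summands exchanged. [cite: SerreTrees1980, Ch. II §1.1] -/
theorem rowSize_mul_eq_of_lt' (A B x₀ x₁ y₀ y₁ : Localization.Away (t : ℤ))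
    (h : tsize t A * max (tsize t x₀) (tsize t x₁) < tsize t B * max (tsize t y₀) (tsize t y₁)) :
    max (tsize t (A * x₀ + B * y₀)) (tsize t (A * x₁ + B * y₁)) =
      tsize t B * max (tsize t y₀) (tsize t y₁) := by
  rw [add_comm (A * x₀), add_comm (A * x₁)]
  exact rowSize_mul_eq_of_lt t B A y₀ y₁ x₀ x₁ h

/-- The top row of `g h` is `g₀₀ · (top row of h) + g₀₁ · (bottom row of h)`: size bound. [cite: SerreTrees1980, Ch. II §1.1] -/
theorem topSize_mul_le (g h : SL(2, Localization.Away (t : ℤ))) :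
    topSize t (g * h) ≤ max (tsize t (g 0 0) * topSize t h) (tsize t (g 0 1) * botSize t h) := by
  simp only [topSize, botSize, Automorphic.SL2Rel.mul_apply_two]
  exact rowSize_mul_le t _ _ _ _ _ _

/-- The bottom row of `g h` is `g₁₀ · (top row of h) + g₁₁ · (bottom row of h)`: size bound. [cite: SerreTrees1980, Ch. II §1.1] -/
theorem botSize_mul_le (g h : SL(2, Localization.Away (t : ℤ))) :
    botSize t (g * h) ≤ max (tsize t (g 1 0) * topSize t h) (tsize t (g 1 1) * botSize t h) := by
  simp only [topSize, botSize, Automorphic.SL2Rel.mul_apply_two]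
  exact rowSize_mul_le t _ _ _ _ _ _

/-- Top row of `g h`: exact size when the `g₀₀`-term dominates. [cite: SerreTrees1980, Ch. II §1.1] -/
theorem topSize_mul_eq_left (g h : SL(2, Localization.Away (t : ℤ)))
    (hlt : tsize t (g 0 1) * botSize t h < tsize t (g 0 0) * topSize t h) :
    topSize t (g * h) = tsize t (g 0 0) * topSize t h := by
  simp only [topSize, botSize, Automorphic.SL2Rel.mul_apply_two] at hlt ⊢
  exact rowSize_mul_eq_of_lt t _ _ _ _ _ _ hlt

/-- Top row of `g h`: exact size when the `g₀₁`-term dominates. [cite: SerreTrees1980, Ch. II §1.1] -/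
theorem topSize_mul_eq_right (g h : SL(2, Localization.Away (t : ℤ)))
    (hlt : tsize t (g 0 0) * topSize t h < tsize t (g 0 1) * botSize t h) :
    topSize t (g * h) = tsize t (g 0 1) * botSize t h := by
  simp only [topSize, botSize, Automorphic.SL2Rel.mul_apply_two] at hlt ⊢
  exact rowSize_mul_eq_of_lt' t _ _ _ _ _ _ hlt

/-- Bottom row of `g h`: exact size when the `g₁₀`-term dominates. [cite: SerreTrees1980, Ch. II §1.1] -/
theorem botSize_mul_eq_left (g h : SL(2, Localization.Away (t : ℤ)))
    (hlt : tsize t (g 1 1) * botSize t h < tsize t (g 1 0) * topSize t h) :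
    botSize t (g * h) = tsize t (g 1 0) * topSize t h := by
  simp only [topSize, botSize, Automorphic.SL2Rel.mul_apply_two] at hlt ⊢
  exact rowSize_mul_eq_of_lt t _ _ _ _ _ _ hlt

/-- Bottom row of `g h`: exact size when the `g₁₁`-term dominates. [cite: SerreTrees1980, Ch. II §1.1] -/
theorem botSize_mul_eq_right (g h : SL(2, Localization.Away (t : ℤ)))
    (hlt : tsize t (g 1 0) * topSize t h < tsize t (g 1 1) * botSize t h) :
    botSize t (g * h) = tsize t (g 1 1) * botSize t h := by
  simp only [topSize, botSize, Automorphic.SL2Rel.mul_apply_two] at hlt ⊢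
  exact rowSize_mul_eq_of_lt' t _ _ _ _ _ _ hlt


end Gamma0Away

end Literature.NumberTheory.EllipticCurves

end
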